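import Summits.AnomalousDissipation.AnomalousDissipation.Theorems.TaylorCertificatesKolmogorovFloorResponseDefs

/-!
# Conjugate symmetry of the closed-form line response (LINE-ALGEBRA stub of line `Sketch`,
# digit-frame-closure, crux stmt-AnomalousDissipation-15122)

For the closed-form response sequences of `Theorems/TaylorCertificatesKolmogorovFloorResponseDefs.lean` (§3), the
reflection of the line data `d = (a, c, s, K, X2, e2, n2) ↦ d' = (−a, −c, −s, K, X2, e2, n2)` (the line of `−k`)
together with conjugation of the force components `F ↦ F' = conj ∘ F` acts by `m ↦ −m` and conjugation:
termwise `E'_j = E_{−j}`, `N'_j = N_{−j}`, `T'_j = −T_{−j}`, `D' = D`, `G'_± = G_∓`, `G' = G`, `σ' = −conj σ`,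
`ρ' = conj ρ`, `ρ̃' = conj ρ̃`, `λ'_± = conj λ_∓`, `Λ'_m = conj Λ_{−m}`, `y'_m = conj y_{−m}`,
`inc'_m = conj inc_{−m}`, `P'_m = −conj P_{−m}` (the defining filters of `P` are reflection-symmetric), hence
`x'_m = conj x_{−m}`, `z'_m = conj z_{−m}` (`refl_xC`, `refl_yC`, `refl_zC`). No hypothesis on the data is needed.
All statements take `d'`, `F'` as variables with defining equations `hd`, `hF`, so that they apply verbatim to
`let`-bound reflected data. Sub-namespace `…KolmogorovFloor.Response.LineAlgebra`.
-/

noncomputable section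

set_option linter.dupNamespace false -- the problem path repeats `AnomalousDissipation` (forced namespace)

open Finset
open scoped BigOperators ComplexConjugate

namespace Summit.AnomalousDissipation.AnomalousDissipation.Theorems.KolmogorovFloor.Response.LineAlgebra

section Refl

variable (d d' : LineData) (F F' : LineForce) (J : ℕ)
  (hd : d' = ⟨-d.a, -d.c, -d.s, d.K, d.X2, d.e2, d.n2⟩)
  (hF : F' = ⟨starRingEnd ℂ F.ve, starRingEnd ℂ F.vx, starRingEnd ℂ F.vn⟩)

include hd in
/-- `E'_j = E_{−j}` for the reflected line data `d' = (−a, −c, −s, K, X2, e2, n2)`. -/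
theorem refl_E (j : ℤ) : d'.E j = d.E (-j) := by
  subst hd; simp only [LineData.E]; ring

include hd in
/-- `N'_j = N_{−j}`. -/
theorem refl_N (j : ℤ) : d'.N j = d.N (-j) := by
  subst hd; simp only [LineData.N]; ring

include hd in
/-- `T'_j = −T_{−j}`. -/
theorem refl_T (j : ℤ) : d'.T j = -d.T (-j) := by
  subst hd; simp only [LineData.T]; ring

include hd in
/-- `D' = D`. -/
theorem refl_D : d'.D = d.D := by
  subst hd; simp only [LineData.D]; ring

include hd in
/-- `G'₊ = G₋`. -/
theorem refl_Gp : d'.Gp J = d.Gm J := by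
  simp only [LineData.Gp, LineData.Gm, refl_E d d' hd]

include hd in
/-- `G'₋ = G₊`. -/
theorem refl_Gm : d'.Gm J = d.Gp J := by
  simp only [LineData.Gm, LineData.Gp, refl_E d d' hd, neg_neg]

include hd in
/-- `G' = G`. -/
theorem refl_G : d'.G J = d.G J := by
  simp only [LineData.G, refl_Gp d d' J hd, refl_Gm d d' J hd, add_comm]

include hd hF in
/-- `σ' = −conj σ`. -/
theorem refl_sigmaC : sigmaC d' F' = -conj (sigmaC d F) := by
  subst hd hF
  simp only [sigmaC, map_div₀, map_mul, map_intCast, Complex.conj_ofReal]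
  push_cast
  ring

include hd hF in
/-- `ρ' = conj ρ`. -/
theorem refl_rhoC : rhoC d' F' = conj (rhoC d F) := by
  subst hd hF
  simp only [rhoC, map_div₀, map_mul, map_sub, map_intCast, Complex.conj_ofReal]
  push_cast
  ring

include hd hF in
/-- `ρ̃' = conj ρ̃`. -/
theorem refl_rhoT : rhoT d' F' = conj (rhoT d F) := by
  rw [rhoT, rhoT, refl_rhoC d d' F F' hd hF]
  subst hd
  simp only [map_div₀, map_mul, map_intCast, map_ofNat]
  push_cast
  ring

include hd hF in
/-- `λ'₊ = conj λ₋`. -/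
theorem refl_lamP : lamP d' F' J = conj (lamM d F J) := by
  rw [lamP, lamM, refl_rhoT d d' F F' hd hF, refl_sigmaC d d' F F' hd hF, refl_Gm d d' J hd,
    refl_G d d' J hd]
  simp only [map_div₀, map_mul, map_add, Complex.conj_ofReal]
  ring

include hd hF in
/-- `λ'₋ = conj λ₊`. -/
theorem refl_lamM : lamM d' F' J = conj (lamP d F J) := by
  rw [lamM, lamP, refl_rhoT d d' F F' hd hF, refl_sigmaC d d' F F' hd hF, refl_Gp d d' J hd,
    refl_G d d' J hd]
  simp only [map_div₀, map_mul, map_sub, Complex.conj_ofReal]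
  ring

include hd hF in
/-- `Λ'_m = conj Λ_{−m}`. -/
theorem refl_Lam (m : ℤ) : Lam d' F' J m = conj (Lam d F J (-m)) := by
  unfold Lam
  rw [abs_neg]
  by_cases h : m % 2 = 0 ∨ 2 * (J : ℤ) + 1 < |m|
  · have h' : (-m) % 2 = 0 ∨ 2 * (J : ℤ) + 1 < |m| := by omega
    rw [if_pos h, if_pos h', map_zero]
  · have h' : ¬((-m) % 2 = 0 ∨ 2 * (J : ℤ) + 1 < |m|) := by omega
    rw [if_neg h, if_neg h']
    by_cases hp : 0 < m
    · rw [if_pos hp, if_neg (show ¬(0 < -m) by omega), refl_lamP d d' F F' J hd hF]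
    · rw [if_neg hp, if_pos (show 0 < -m by omega), refl_lamM d d' F F' J hd hF]

include hd hF in
/-- **Conjugate symmetry of `y`**: `y'_m = conj y_{−m}`. -/
theorem refl_yC (m : ℤ) : yC d' F' J m = conj (yC d F J (-m)) := by
  unfold yC
  rw [refl_Lam d d' F F' J hd hF, refl_E d d' hd, map_div₀, map_intCast]

include hd hF in
/-- `inc'_m = conj inc_{−m}`. -/
theorem refl_incC (m : ℤ) : incC d' F' J m = conj (incC d F J (-m)) := by
  unfold incC
  rw [refl_yC d d' F F' J hd hF, refl_yC d d' F F' J hd hF, refl_rhoC d d' F F' hd hF,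
    show -(m - 1) = -m + 1 by ring, show -(m + 1) = -m - 1 by ring]
  subst hd
  by_cases h0 : m = 0
  · rw [if_pos h0, if_pos (neg_eq_zero.mpr h0)]
    simp only [map_sub, map_mul, map_div₀, map_add, map_intCast]
    push_cast
    ring
  · rw [if_neg h0, if_neg (fun h => h0 (neg_eq_zero.mp h))]
    simp only [map_sub, map_mul, map_div₀, map_add, map_intCast, map_zero]
    push_cast
    ring

include hd hF in
/-- `P'_m = −conj P_{−m}` (the defining filters are reflection-symmetric). -/
theorem refl_PC (m : ℤ) : PC d' F' J m = -conj (PC d F J (-m)) := by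
  unfold PC
  by_cases h2 : m % 2 = 0
  · rw [if_pos h2, if_pos (show (-m) % 2 = 0 by omega), map_zero, neg_zero]
  · rw [if_neg h2, if_neg (show ¬((-m) % 2 = 0) by omega)]
    by_cases hp : 0 < m
    · rw [if_pos hp, if_neg (show ¬(0 < -m) by omega), neg_neg, map_sum]
      congr 1
      refine Finset.sum_congr rfl (fun i _ => ?_)
      rw [refl_incC d d' F F' J hd hF]
    · rw [if_neg hp, if_pos (show 0 < -m by omega), map_neg, neg_neg, map_sum]
      refine Finset.sum_congr rfl (fun i _ => ?_)
      rw [refl_incC d d' F F' J hd hF, neg_neg]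

include hd hF in
/-- **Conjugate symmetry of `x`**: `x'_m = conj x_{−m}`. -/
theorem refl_xC (m : ℤ) : xC d' F' J m = conj (xC d F J (-m)) := by
  unfold xC
  rw [refl_PC d d' F F' J hd hF, refl_yC d d' F F' J hd hF, refl_T d d' hd, refl_D d d' hd]
  subst hd
  simp only [map_sub, map_mul, map_div₀, map_intCast]
  push_cast
  ring

include hd hF in
/-- **Conjugate symmetry of `z`**: `z'_m = conj z_{−m}`. -/
theorem refl_zC (m : ℤ) : zC d' F' J m = conj (zC d F J (-m)) := by
  unfold zC
  rw [refl_PC d d' F F' J hd hF, refl_yC d d' F F' J hd hF, refl_T d d' hd, refl_D d d' hd]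
  subst hd
  simp only [map_sub, map_mul, map_div₀, map_neg, map_intCast]
  push_cast
  ring

end Refl

end Summit.AnomalousDissipation.AnomalousDissipation.Theorems.KolmogorovFloor.Response.LineAlgebra
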